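import Literature.MathematicalPhysics.QuantumFieldTheory.Balaban1983to89.B9Cor36SiteSandwichTransferSrcGlobalBlocks
import Literature.MathematicalPhysics.QuantumFieldTheory.Balaban1983to89.B9Cor36GCubeLocAtMember
import Literature.MathematicalPhysics.QuantumFieldTheory.Balaban1983to89.B9CubeDirInverseBondCGaugeCovY
import Literature.MathematicalPhysics.QuantumFieldTheory.Balaban1983to89.B9CubeDirInverseBondCLocalityAtRecordY

/-!
# `Balaban1983to89.B9CubeDirInverseBondCAtMemberBlocksY` — [Balaban1985BackgroundPropagators] COROLLARY 3.6 p. 408 ∕ p. 409 l. 1–5 FOR PRINT's DIRICHLET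
# BOND LETTER OF THE CUBE SEQUENCE (letter (C) of record, `GDirCKY`), MEMBER SIDE: the four (3.42)-block rows and the regime clause of `G_□(U)` AT THE
# MEMBER's configuration `U`, over ALL the member's blocks, FROM the four rows AT A SMALL FIELD `Ṽ` over the cube sequence's blocks — «all the results of
# these theorems are gauge invariant, so they hold for the configuration U also» — by covariance (3.34), locality (p. 410 l. 14–15) and ONE [4]-(2.61) sum

T. Bałaban, *Propagators for lattice gauge theories in a background field*, Commun. Math. Phys. **99** (1985) 389–434 [`Balaban1985BackgroundPropagators`, "B9"]
(held `paper:balaban1985-cmp99-background-propagators`; journal page = PDF page + 388; page owner r06); [4] = T. Bałaban, *Propagators and renormalization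
transformations for lattice gauge theories. II*, Commun. Math. Phys. **96** (1984) 223–250 [`Balaban1984PropagatorsII`].

statement-level skeleton of published theorems with citation tags; proofs where landed; nothing here is a claim about the Yang–Mills mass gap

THE PRINTED LOCI (verbatim up to notation).  Cor. 3.6 p. 408: «If a configuration U satisfies (3.35) with O(1)Mα₀ ≦ α₁, and Ω′₀ ⊂ □̃ for a cube □ of the class
described in this condition, then Theorems 3.1–3.3 hold for the operators G′(U), (Q′(U)G′²(U)Q′*(U))⁻¹, G(U) constructed for the sequence {Ω′_j}. This follows from
Corollary 3.5 applied to the configuration U′ = U^u, and we have to recall only that all the results of these theorems are gauge invariant.»; p. 409 l. 1–5: «The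
operators constructed for this sequence, which we denote by G′_□(U), C_□(U), G_□(U), satisfy all the inequalities of Theorems 3.1–3.3 correspondingly»; (3.34)
p. 396: «G(U^u) = R(u)G(U)R(u⁻¹)»; (3.31) p. 395 (the covariant derivatives are covariant); p. 410 l. 14–15: «the operators G′_□(U), … depend on U restricted to
Ω₀(□)»; Thm 3.3 p. 399 («with G′(U) replaced by G(U) and λ replaced by a function J defined at bonds»), Thm 3.1 (3.42) p. 397 («y, y′ ∈ 𝔅»).  [4] (2.51)–(2.52)
p. 232 («|(Tλ)(x)| ≦ K(y,y′)|λ|», «this property is preserved under the composition»), (2.46) p. 231, Lemma 2.1 (2.61) p. 234 («Σ_{y′} e^{−αδ₀d(y,y′)} ≦ c₁»).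

WHY THIS FILE (cell `pub-ymgap`, HUMAN RULING D-0062, Track A node N06; seat `pub-ymgap-dag-n06-d` g35, INTENT-2, the member-side half of dag-n06-c's road
(B5) step 7 «covariance to raw U + member-block reading» FOR THE BOND LETTER OF RECORD).  The heads «KE₁₉X-C» ∕ «KESC-CM» display the bond rows `h36Ab`
(four `HasMajorant` block majorants of `conj b(G_□(U))`, `conj b(∇_{U,ν})·conj b(G_□(U))`, `conj b(G_□(U))·conj b(∇*_{U,ν})`, `conj b(Δ_U)·conj b(G_□(U))` over
the member's all-blocks geometry keyed by `y(b₋)`) and the regime clause `hUnitA` (`IsUnit padΔ_{loc,□}[Q^knit_□](U)`), at EVERY `U` of the (3.35) class; the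
supplier chain (dag-n06-c) produces them AT A SMALL FIELD `Ṽ = Uᵘ` near `Ω₀(□)` over the CUBE SEQUENCE's blocks.  This file is the transfer `Ṽ ↦ U` for the
letter of record, keyed on the landed covariance ✓`B9CubeDirInverseBondCGaugeCovY.GDirCKY_cov` and locality ✓`B9CubeDirInverseBondCLocalityAtRecordY.
GDirCKY_congr_of_agreeDirCY`: `G_□(U) = R(u)⁻¹G_□(Uᵘ)R(u) = R(u)⁻¹G_□(Ṽ)R(u)`, and for the derivative words `∇_{U,ν}R(u)⁻¹ = R(u)⁻¹∇_{Uᵘ,ν}` (3.31) with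
`∇_{Uᵘ,ν} = ∇_{Ṽ,ν}` ON THE `Ω₀(□)`-SUPPORTED OUTPUT of `G_□ = 𝟙_{Ω₀}G_□𝟙_{Ω₀}` (clause (i) of `AgreeDirCY` is exactly what `∇, ∇*, Δ` read there).  The
carrier transfer (cube-sequence blocks → member blocks) cannot use the tree's bond transfers: `B9Cor36BondSandwichTransferBlocks` needs a source cut-off near □
and `B9Cor36BondSandwichTransferSrc` a section `ιB` of `β`, while at print's placement `Ω₀(□) ⊄ NearH(□)` (seat g32 KEY FINDING) and cornered members have
no section; §1 is therefore the BOND twin of dag-n06-c's source-global all-blocks SITE transfer ✓`B9Cor36SiteSandwichTransferSrcGlobalBlocks` (verbatim port).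

WHAT THIS FILE PROVES (THEOREMS; 0 `def`, 0 `def … : Prop`, 0 sorry; standard axioms).
* §1 ★★ `hasMajorant_conj_bond_sandwich_src_global_blocks` ∕ ★★ `hasMajorant_conj_bond_sandwich_src_global_decay_blocks` — bond twins of dag-n06-c's site
  theorems: `conj b(M_{g₁}∘R(γ)⁻¹∘M∘R(γ)) ≺ (M₂Σ‖b‖)²·K` over `(toB6 (geoBK i) Rr′ Hp, (f,j) ↦ y(f₋))` from `conj b(M) ≺ B_C·w(a)·e^{−δd_□}` over
  `(toB6 (geoCK i □) Rr H, blkBK i □)`, one (2.61) sum, NO source cut-off, NO section.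
* §2 the gauge-free localisation of the member's bond derivatives on `𝟙_{Ω₀}`-supported functions (`cdB_eq_of_agree_of_supp`, `indProjY_cdsB_eq_of_agree`,
  `lapB_eq_of_agree_of_supp`), the conjugation bookkeeping (`conjY_inv_conjY`, `rs_eq_sandwich_of_intw`), and the three sandwich identities ★`cdBₗ_comp_sandwich`,
  ★`sandwich_comp_cdsBₗ`, ★`lapBₗ_comp_sandwich` for an `Ω₀`-supported `X`: `∇_{U,ν}∘(R(u)⁻¹XR(u)) = R(u)⁻¹(∇_{Ṽ,ν}X)R(u)` etc.
* §3 ★★ `transfer_sandwich_decay` (one word) and ★★ `covBondLetter_at_member_blocks_of_entries` — for ANY `ℂ`-linear bond operator `X` (the letter at `Ṽ`)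
  with `𝟙_{Ω₀}X = X = X𝟙_{Ω₀}` and any `XU` (the letter at `U`) with `XU = R(u)⁻¹XR(u)`: the four cube-side rows at `Ṽ` give the four member-side rows at `U`
  with constant `(M₂Σ‖b‖)²·B·c₁(δ,α)` and rate `(1−α)δ`.
* §4 ★★★ `gDirCK_at_member_blocks_of_entries` and ★★ `isUnit_padDeltaLocCKY_of_datum` AT THE LETTER OF RECORD `GDirCKY i □ (DP_□D* of record) (bondsOverY Ω₀)`,
  unitary-valued `u`, `AgreeDirCY Ω₀ (Uᵘ) Ṽ`: the `h36Ab`-shaped rows and the `hUnitA` clause at `U` from the rows ∕ clause at `Ṽ` — covariance, locality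
  and support DISCHARGED BY NAME (`GDirCKY_cov`, `isUnit_padDeltaLocCKY_gaugeY_iff`, `GDirCKY_congr_of_agreeDirCY`, `isUnit_padDeltaLocCY_knit_iff_of_agreeDirCY`,
  `indProjY_mul_GDirCY`, `GDirCY_mul_indProjY`).

HONEST SCOPE ∕ NOT CLAIMED.  Carrier ∕ gauge bookkeeping over landed modules; NO estimate: the cube-side rows at `Ṽ` (Cor. 3.5 ∕ (3.85) for the Dirichlet bond
letter, dag-n06-c's road (B5)) and the existence of the datum `(u, Ṽ)` (the (3.35) gauge on a class cube) are HYPOTHESES here, displayed verbatim; the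
flat-to-covariant conversion of the derivative letters at `Ṽ` is NOT here (the inputs are in the covariant-at-`Ṽ` letters `cdBₗ i Ṽ ν`, `cdsBₗ i Ṽ ν`, `lapBₗ i Ṽ`).
The heads are NOT edited by this file (the `h36Ab` edition follows by the `h36b` recipe once the cube-side rows exist).  Print needs no such transfer beyond the
sentence quoted (its kernel bounds are pointwise on the cube sequence); this is (R)-design bookkeeping for def-Y's member-level block majorants.  Count-neutral;
N06 NOT discharged; nothing on `d = 4`, the continuum, reflection positivity, the mass gap or Clay; YM mass gap NOT proved.  No `sorry`, no `axiom`, no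
`… : Prop` fact, no `instance`, no `notation`, no `def`.  NEW file; nothing landed is modified.  `--supports stmt-QuantumFields-27239`.  Net new unproved facts: 0.

RELATED IN THE TREE, NOT DUPLICATED (searched 2026-08-31 18:5xZ: `rg` for the basename and the §1–§4 names over `lean/Literature/MathematicalPhysics` +
`lean/Summits/QuantumFields` — 0 hits): dag-n06-c `B9Cor36SiteSandwichTransferSrcGlobalBlocks` (§1's site original, transplanted letter by letter),
`B9Cor36BondSandwichTransferBlocks` (source cut-off near □), lit-balaban-p38 `B9Cor36BondSandwichTransferSrc` (section `ιB`), `B9Cor36GCubeLocAtMember` ∕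
dag-n06-c `B9Cor36GCubeLocAtBlocks` (the same transfer for the (R)-design letter `χR(u)⁻¹G_□(Ṽ)R(u)χ` with `G_□ = Δ_{a,□}⁻¹`; their `transport_*`, `cdB_congr_pt`
pattern USED BY NAME), dag-n06-c `B9Cor36GpDirAtMemberBlocks` (the site-sector analogue for `G′_□(U)`, whose `h36b` row this seat consumed in «KE₁₅X-Aγ»).
-/

noncomputable section

namespace Literature.MathematicalPhysics.QuantumFieldTheory.Balaban1983to89.B9CubeDirInverseBondCAtMemberBlocksY

open B6RandomWalk (HasMajorant BlockSupp hasMajorant_mono Ineq261 c1_nonneg)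
open B9Thm34Ext (toB6)
open B9Eq39Adjoint (R R_zero)
open B9Eq352DivFormLetters (conj conj_apply conj_mul coordEquiv coordEquiv_apply coordEquiv_symm_apply norm_coordSymm_apply_le)
open B6KLevelCensusIndexV1 (KIdx)
open B6Cover236MultiLevelBlocks (cubes)
open B6Geom246MultiLevelBox (blkOf)
open B6GlobalChartV1 (PV blkV1)
open B9CubeLettersBondOpsL0 (BlkCubeY)
open B9Eq360DeltaPrimeACubeY (blkCubeY)
open B9CubeGeometryInputs (geoCK geoCK_len_pos)
open B9Thm37CubeCoverCommutators (cutMulY cutMulY_apply)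
open B9Cor36CinvCubeLocLetterMajorant (norm_le_sum_mul_of_repr_le)
open B9Cor36SiteSandwichTransferBlocks (dist_block_le_dist_cube len_cube_le_len_block)
open B9Cor36BondSandwichTransferSrc (exp_split_le)
open B9SectBAllBlocksGeometryY (geoBK geoBK_len_pos)
open B9Cor35GCubeInputsAtOne (blkBK)
open B9CubeLettersInvReadings (cdB_conj cdsB_conj lapB_conj)
open B9Thm310CutoffLapTermsB (cdB_apply_eq cdsB_apply_eq)
open B9Thm310CommutatorDataOfPlaquettes (UboxY_chartY)
open B9Cor36GCubeLocAtMember (cdB_congr_pt cdsB_congr_pt)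
open B9Cor36GpCubeLocAtMember (hasMajorant_congr_op)
open B9CoReadingCoords (cdBₗ cdsBₗ lapBₗ cdBₗ_apply cdsBₗ_apply lapBₗ_apply)
open B9DirichletBondCubePairY (padDeltaLocCY GDirCY indProjY_mul_GDirCY GDirCY_mul_indProjY)
open B9Eq3115KnitCubeLetterY (knitDepP QknitCubeY QsknitCubeY GDirCKY)
open B9CubeDirInverseBondCLocalityAtRecordY (AgreeDirCY GDirCKY_congr_of_agreeDirCY isUnit_padDeltaLocCY_knit_iff_of_agreeDirCY)
open B9CubeDirInverseBondCGaugeCovY (GDirCKY_cov isUnit_padDeltaLocCKY_gaugeY_iff)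
open B7Prop2Explicit (unitaryUnits)
open B9B8KnitAveragingClosenessOfColumns (norm_R_le_of_mem_unitaryUnits)
open Node00
open Node00.OpsYNablaBridge (chartY shiftY_chartY shiftY_symm_chartY shift_unshift)
open Node00.OpsYCubeDirInverseBond (indProjY indProjY_apply bondsOverY mem_bondsOverY)
open Node00.OpsYCubeProjectionG (DPDsDirCubeY)

variable {d ℓ : ℕ} {hd : 1 ≤ d + 1} {hL : Odd (ℓ + 1) ∧ 1 < ℓ + 1} {b₀ b₁ : ℝ}
variable {𝔸 : Type} [NormedRing 𝔸] [NormedAlgebra ℂ 𝔸] [CompleteSpace 𝔸]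
variable {ι : Type} [Fintype ι]

/-! ## §1  ★★ The source-global BOND sandwich transfer: cube-sequence blocks → all the member's blocks, keyed by `y(b₋)`, one (2.61) sum -/

section Transfer

variable (i : KIdx d ℓ hd hL b₀ b₁) (c : ↥(cubes (toKT i).D.toDomains)) (b : Module.Basis ι ℝ 𝔸)

omit [CompleteSpace 𝔸] in
/-- ★★ **THE SOURCE-GLOBAL BOND SANDWICH TRANSFER, ALL-BLOCKS KEY** (bond twin of dag-n06-c's `hasMajorant_conj_site_sandwich_src_global_blocks`).  Let `γ` be a
bi-contractive unit field on bonds, `g₁` a real row multiplier with `|g₁(f)| ≤ G₁(Δ_□(f₋))`, and let `conj b(M)` have the block majorant `B_C·w(a)·e^{−δ·d_□(a,s)}`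
over the cube sequence's bond carrier `(toB6 (geoCK i □) Rr H, blkBK i □)` (`w ≥ 0`, `δ ≥ 0`); assume (2.61) on the cube geometry at the splitting exponent
`α ≤ 1` and let `K` dominate `G₁(Δ_□f)·w(Δ_□f)·B_C·c₁(δ,α)·e^{−(1−α)δ·d(y(f₋),a′)}`.  Then `conj b(M_{g₁}∘R(γ)⁻¹∘M∘R(γ)) ≺ (M₂Σ‖b_j‖)²·K` over the member's
all-blocks bond carrier `(toB6 (geoBK i) Rr′ Hp, (f,j) ↦ y(f₋))`.  A member source in the block `y′` splits into its cube-block pieces; pieces outside `y′`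
vanish, the others have `d(a,y′) ≤ d_□(a,s)` and the splitting costs `Σ_s e^{−αδd_□(a,s)} ≤ c₁`.  NO source cut-off, NO section, NO nearness to □.
A carrier-transfer lemma; no printed inequality is claimed proved by it.
[cite: Balaban1985BackgroundPropagators, Cor. 3.6 p.408 l.11–14, p.409 l.1–5, Thm 3.3 p.399; Balaban1984PropagatorsII, (2.51)–(2.52) p.232, (2.46) p.231, Lemma 2.1 (2.61) p.234] -/
theorem hasMajorant_conj_bond_sandwich_src_global_blocks {M₂ : ℝ} (hM₂ : 0 ≤ M₂) (hrepr : ∀ (v : 𝔸) (j : ι), |b.repr v j| ≤ M₂ * ‖v‖)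
    (γ : FBondY i → 𝔸ˣ) (hγ : ∀ f a, ‖R (γ f) a‖ ≤ ‖a‖ ∧ ‖R (γ f)⁻¹ a‖ ≤ ‖a‖)
    (g₁ : FBondY i → ℝ) (G₁ : BlkCubeY i c → ℝ) (hG₁ : ∀ f, |g₁ f| ≤ G₁ (blkCubeY i c (chartY i f.src)))
    (Rr : ℝ) (H : Prop) [Fintype (geoBK i).Site] (Rr' : ℝ) (Hp : Prop)
    (dB : ℕ) {BC δ α : ℝ} (hBC : 0 ≤ BC) (hδ : 0 ≤ δ) (hα1 : α ≤ 1) (w : BlkCubeY i c → ℝ) (hw : ∀ s, 0 ≤ w s)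
    (h261 : Ineq261 dB (toB6 (geoCK i c) Rr H) δ α)
    {K : (geoBK i).Site → (geoBK i).Site → ℝ}
    (hcmp : ∀ (f : FBondY i) (a' : (geoBK i).Site),
      G₁ (blkCubeY i c (chartY i f.src)) * w (blkCubeY i c (chartY i f.src)) * (BC * B6.c1 dB δ α) *
          Real.exp (-((1 - α) * δ * (geoBK i).dist (blkV1 i.hN i.D f) a')) ≤
        K (blkV1 i.hN i.D f) a')
    (M : Module.End ℝ (FBondY i → 𝔸))
    (hM : HasMajorant (g := toB6 (geoCK i c) Rr H) (blkBK i c) (conj b M)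
      (fun a s => BC * w a * Real.exp (-(δ * (geoCK i c).dist a s)))) :
    HasMajorant (g := toB6 (geoBK i) Rr' Hp) (fun p : FBondY i × ι => blkV1 i.hN i.D p.1)
      (conj b ((cutMulY (𝔸 := 𝔸) g₁).restrictScalars ℝ ∘ₗ (conjY γ⁻¹).restrictScalars ℝ ∘ₗ M ∘ₗ (conjY γ).restrictScalars ℝ))
      (fun a a' => (M₂ * ∑ j, ‖b j‖) ^ 2 * K a a') := by
  classical
  intro y' μ B hμ x
  have hSb : 0 ≤ ∑ j, ‖b j‖ := Finset.sum_nonneg fun _ _ => norm_nonneg _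
  -- the source as an `𝔸`-valued bond function, rotated; its cube-block pieces
  set lam : FBondY i → 𝔸 := (coordEquiv b).symm μ with hlam
  set ν : FBondY i → 𝔸 := conjY γ lam with hν
  set νs : BlkCubeY i c → FBondY i → 𝔸 := fun s v => if blkCubeY i c (chartY i v.src) = s then ν v else 0 with hνs
  have hsum : ν = ∑ s, νs s := by
    funext v
    rw [Finset.sum_apply]
    simp only [hνs]
    rw [Finset.sum_ite_eq]
    simp only [Finset.mem_univ, if_true]
  rw [conj_apply]
  simp only [LinearMap.comp_apply, LinearMap.restrictScalars_apply]
  rw [← hlam]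
  change |b.repr (cutMulY g₁ (conjY γ⁻¹ (M ν)) x.1) x.2| ≤ (M₂ * ∑ j, ‖b j‖) ^ 2 * K (blkV1 i.hN i.D x.1) y' * B
  rw [cutMulY_apply, conjY_apply, Pi.inv_apply]
  -- the row factor
  have hG₁0 : 0 ≤ G₁ (blkCubeY i c (chartY i x.1.src)) := (abs_nonneg _).trans (hG₁ x.1)
  have hrowfac : |b.repr ((((g₁ x.1 : ℝ) : ℂ)) • R (γ x.1)⁻¹ (M ν x.1)) x.2| ≤ M₂ * (G₁ (blkCubeY i c (chartY i x.1.src)) * ‖M ν x.1‖) := by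
    refine (hrepr _ _).trans (mul_le_mul_of_nonneg_left ?_ hM₂)
    rw [norm_smul, Complex.norm_real, Real.norm_eq_abs]
    exact mul_le_mul (hG₁ x.1) ((hγ x.1 _).2) (norm_nonneg _) hG₁0
  -- the source: values bounded by `(Σ‖b‖)·B`, zero off the member block over `y′`
  have hlam_bd : ∀ v, ‖lam v‖ ≤ (∑ j, ‖b j‖) * B := fun v => by
    by_cases hv : blkV1 i.hN i.D v = y'
    · rw [hlam]; exact norm_coordSymm_apply_le b μ v B fun j => hμ.bound (v, j) hv
    · have h0 : lam v = 0 := by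
        rw [hlam, coordEquiv_symm_apply]
        exact Finset.sum_eq_zero fun j _ => by rw [hμ.off (v, j) hv, zero_smul]
      rw [h0, norm_zero]; exact mul_nonneg hSb hμ.nonneg
  have hlam_off : ∀ v, blkV1 i.hN i.D v ≠ y' → lam v = 0 := fun v hv => by
    rw [hlam, coordEquiv_symm_apply]
    exact Finset.sum_eq_zero fun j _ => by rw [hμ.off (v, j) hv, zero_smul]
  have hν_val : ∀ v, ν v = R (γ v) (lam v) := fun v => by rw [hν, conjY_apply]
  have hν_bd : ∀ v, ‖ν v‖ ≤ (∑ j, ‖b j‖) * B := fun v => by rw [hν_val]; exact ((hγ v _).1).trans (hlam_bd v)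
  -- each piece is a cube-side source supported in its cube block
  have hνsupp : ∀ s, BlockSupp (g := toB6 (geoCK i c) Rr H) (blkBK i c) (coordEquiv b (νs s)) s (M₂ * ((∑ j, ‖b j‖) * B)) := fun s => by
    refine ⟨mul_nonneg hM₂ (mul_nonneg hSb hμ.nonneg), fun p hp => ?_, fun p hp => ?_⟩
    · rw [coordEquiv_apply]
      refine (hrepr _ _).trans (mul_le_mul_of_nonneg_left ?_ hM₂)
      simp only [hνs]
      split_ifs
      · exact hν_bd p.1
      · rw [norm_zero]; exact mul_nonneg hSb hμ.nonneg
    · rw [coordEquiv_apply]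
      have hp' : ¬ blkCubeY i c (chartY i p.1.src) = s := hp
      simp only [hνs, if_neg hp', map_zero, Finsupp.zero_apply]
  -- the cube-side majorant on each piece
  have hpiece : ∀ s, ‖M (νs s) x.1‖ ≤
      (∑ j, ‖b j‖) * (BC * w (blkCubeY i c (chartY i x.1.src)) * Real.exp (-(δ * (geoCK i c).dist (blkCubeY i c (chartY i x.1.src)) s)) *
        (M₂ * ((∑ j, ‖b j‖) * B))) := fun s =>
    norm_le_sum_mul_of_repr_le b _ fun j' => by
      have h := hM s (coordEquiv b (νs s)) _ (hνsupp s) (x.1, j')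
      rwa [conj_apply, LinearEquiv.symm_apply_apply] at h
  -- inactive pieces vanish; active pieces lie under `y′`, where `d(a,y′) ≤ d_□(a,s)`
  set Em : ℝ := Real.exp (-((1 - α) * δ * (geoBK i).dist (blkV1 i.hN i.D x.1) y')) with hEm
  have hwB : 0 ≤ BC * w (blkCubeY i c (chartY i x.1.src)) := mul_nonneg hBC (hw _)
  have hMB : 0 ≤ M₂ * ((∑ j, ‖b j‖) * B) := mul_nonneg hM₂ (mul_nonneg hSb hμ.nonneg)
  have hpiece' : ∀ s, ‖M (νs s) x.1‖ ≤
      (∑ j, ‖b j‖) * (BC * w (blkCubeY i c (chartY i x.1.src)) * (Em * Real.exp (-(α * δ * (geoCK i c).dist (blkCubeY i c (chartY i x.1.src)) s))) *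
        (M₂ * ((∑ j, ‖b j‖) * B))) := fun s => by
    by_cases hs : ∃ v₀, lam v₀ ≠ 0 ∧ blkCubeY i c (chartY i v₀.src) = s
    · obtain ⟨v₀, hv₀, hs₀⟩ := hs
      have hy' : blkV1 i.hN i.D v₀ = y' := by
        by_contra h; exact hv₀ (hlam_off v₀ h)
      have hy'' : blkOf i.D.toDomains (chartY i v₀.src) = y' := hy'
      have hdD := dist_block_le_dist_cube i c (chartY i x.1.src) (chartY i v₀.src)
      rw [hs₀, hy''] at hdD
      refine (hpiece s).trans (mul_le_mul_of_nonneg_left (mul_le_mul_of_nonneg_right (mul_le_mul_of_nonneg_left ?_ hwB) hMB) hSb)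
      rw [hEm]
      exact exp_split_le hδ hα1 hdD
    · have h0 : νs s = 0 := funext fun v => by
        simp only [hνs]
        split_ifs with hv
        · have hl : lam v = 0 := by
            by_contra hl; exact hs ⟨v, hl, hv⟩
          rw [hν_val, hl, R_zero]; rfl
        · rfl
      rw [h0, map_zero, Pi.zero_apply, norm_zero]
      exact mul_nonneg hSb (mul_nonneg (mul_nonneg hwB (mul_nonneg (Real.exp_nonneg _) (Real.exp_nonneg _))) hMB)
  -- summing the pieces: one (2.61) sum
  have hMν : M ν x.1 = ∑ s, M (νs s) x.1 := by
    rw [hsum, map_sum, Finset.sum_apply]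
  have h261x := h261 (blkCubeY i c (chartY i x.1.src))
  have hnorm : ‖M ν x.1‖ ≤ (∑ j, ‖b j‖) * (BC * w (blkCubeY i c (chartY i x.1.src)) * (Em * B6.c1 dB δ α) * (M₂ * ((∑ j, ‖b j‖) * B))) := by
    rw [hMν]
    refine (norm_sum_le _ _).trans ((Finset.sum_le_sum fun s _ => hpiece' s).trans ?_)
    have hfac : ∀ s : BlkCubeY i c,
        (∑ j, ‖b j‖) * (BC * w (blkCubeY i c (chartY i x.1.src)) * (Em * Real.exp (-(α * δ * (geoCK i c).dist (blkCubeY i c (chartY i x.1.src)) s))) *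
          (M₂ * ((∑ j, ‖b j‖) * B))) =
        ((∑ j, ‖b j‖) * (BC * w (blkCubeY i c (chartY i x.1.src)) * Em * (M₂ * ((∑ j, ‖b j‖) * B)))) *
          Real.exp (-(α * δ * (geoCK i c).dist (blkCubeY i c (chartY i x.1.src)) s)) := fun s => by ring
    simp_rw [hfac]
    rw [← Finset.mul_sum]
    calc ((∑ j, ‖b j‖) * (BC * w (blkCubeY i c (chartY i x.1.src)) * Em * (M₂ * ((∑ j, ‖b j‖) * B)))) *
          ∑ s, Real.exp (-(α * δ * (geoCK i c).dist (blkCubeY i c (chartY i x.1.src)) s))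
        ≤ ((∑ j, ‖b j‖) * (BC * w (blkCubeY i c (chartY i x.1.src)) * Em * (M₂ * ((∑ j, ‖b j‖) * B)))) * B6.c1 dB δ α :=
          mul_le_mul_of_nonneg_left h261x (mul_nonneg hSb (mul_nonneg (mul_nonneg hwB (Real.exp_nonneg _)) hMB))
      _ = _ := by ring
  -- assembling
  have hc : G₁ (blkCubeY i c (chartY i x.1.src)) * w (blkCubeY i c (chartY i x.1.src)) * (BC * B6.c1 dB δ α) * Em ≤ K (blkV1 i.hN i.D x.1) y' :=
    hcmp x.1 y'
  calc |b.repr ((((g₁ x.1 : ℝ) : ℂ)) • R (γ x.1)⁻¹ (M ν x.1)) x.2| ≤ M₂ * (G₁ (blkCubeY i c (chartY i x.1.src)) * ‖M ν x.1‖) := hrowfac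
    _ ≤ M₂ * (G₁ (blkCubeY i c (chartY i x.1.src)) *
          ((∑ j, ‖b j‖) * (BC * w (blkCubeY i c (chartY i x.1.src)) * (Em * B6.c1 dB δ α) * (M₂ * ((∑ j, ‖b j‖) * B))))) :=
        mul_le_mul_of_nonneg_left (mul_le_mul_of_nonneg_left hnorm hG₁0) hM₂
    _ = (M₂ * ∑ j, ‖b j‖) ^ 2 * (G₁ (blkCubeY i c (chartY i x.1.src)) * w (blkCubeY i c (chartY i x.1.src)) * (BC * B6.c1 dB δ α) * Em) * B := by
        ring
    _ ≤ (M₂ * ∑ j, ‖b j‖) ^ 2 * K (blkV1 i.hN i.D x.1) y' * B :=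
        mul_le_mul_of_nonneg_right (mul_le_mul_of_nonneg_left hc (sq_nonneg _)) hμ.nonneg

omit [CompleteSpace 𝔸] in
/-- ★★ **THE SOURCE-GLOBAL BOND SANDWICH TRANSFER FOR `K_C = B·ℓ_□(a)ⁿ·e^{−δd_□(a,s)}`, ROW MULTIPLIER `|g₁|·ℓ_□ᵐ ≤ c₁` (`m ≤ n`), NO SOURCE CUT-OFF, ALL-BLOCKS KEY**:
with (2.61) on the cube geometry at the splitting exponent `α ≤ 1`,
`conj b(M_{g₁}∘R(γ)⁻¹∘M∘R(γ)) ≺ (M₂Σ‖b‖)²·(c₁·B·c₁(δ,α))·ℓ(a)^{n−m}·e^{−(1−α)δ·d(a,a′)}` over the member's all-blocks bond carrier — levels only grow and distances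
only shrink under coarsening (bond twin of dag-n06-c's `hasMajorant_conj_site_sandwich_src_global_decay_blocks`).  A carrier-transfer lemma; no printed inequality
is claimed proved by it.
[cite: Balaban1985BackgroundPropagators, Cor. 3.6 p.408 l.11–14, p.409 l.1–5, Thm 3.1 (3.42) p.397, Thm 3.3 p.399; Balaban1984PropagatorsII, (2.51) p.232, (2.46) p.231, Lemma 2.1 (2.61) p.234] -/
theorem hasMajorant_conj_bond_sandwich_src_global_decay_blocks {M₂ : ℝ} (hM₂ : 0 ≤ M₂) (hrepr : ∀ (v : 𝔸) (j : ι), |b.repr v j| ≤ M₂ * ‖v‖)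
    (γ : FBondY i → 𝔸ˣ) (hγ : ∀ f a, ‖R (γ f) a‖ ≤ ‖a‖ ∧ ‖R (γ f)⁻¹ a‖ ≤ ‖a‖)
    (g₁ : FBondY i → ℝ) {c₁ : ℝ} (hc₁ : 0 ≤ c₁) {m n : ℕ} (hmn : m ≤ n)
    (hg₁ : ∀ f, |g₁ f| * (geoCK i c).len (blkCubeY i c (chartY i f.src)) ^ m ≤ c₁)
    (Rr : ℝ) (H : Prop) [Fintype (geoBK i).Site] (Rr' : ℝ) (Hp : Prop)
    (dB : ℕ) {B δ α : ℝ} (hB : 0 ≤ B) (hδ : 0 ≤ δ) (hα1 : α ≤ 1) (h261 : Ineq261 dB (toB6 (geoCK i c) Rr H) δ α)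
    (M : Module.End ℝ (FBondY i → 𝔸))
    (hM : HasMajorant (g := toB6 (geoCK i c) Rr H) (blkBK i c) (conj b M)
      (fun a s => B * (geoCK i c).len a ^ n * Real.exp (-(δ * (geoCK i c).dist a s)))) :
    HasMajorant (g := toB6 (geoBK i) Rr' Hp) (fun p : FBondY i × ι => blkV1 i.hN i.D p.1)
      (conj b ((cutMulY (𝔸 := 𝔸) g₁).restrictScalars ℝ ∘ₗ (conjY γ⁻¹).restrictScalars ℝ ∘ₗ M ∘ₗ (conjY γ).restrictScalars ℝ))
      (fun a a' => (M₂ * ∑ j, ‖b j‖) ^ 2 * (c₁ * B * B6.c1 dB δ α) * (geoBK i).len a ^ (n - m) *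
        Real.exp (-((1 - α) * δ * (geoBK i).dist a a'))) := by
  have hlenpos : ∀ s : BlkCubeY i c, 0 < (geoCK i c).len s := fun s => geoCK_len_pos i c s
  refine hasMajorant_mono (g := toB6 (geoBK i) Rr' Hp) _
    (hasMajorant_conj_bond_sandwich_src_global_blocks i c b hM₂ hrepr γ hγ g₁ (fun s => c₁ * ((geoCK i c).len s ^ m)⁻¹) (fun f => ?_)
      Rr H Rr' Hp dB hB hδ hα1 (fun s => (geoCK i c).len s ^ n) (fun s => pow_nonneg (hlenpos s).le _) h261
      (K := fun a a' => (c₁ * B * B6.c1 dB δ α) * (geoBK i).len a ^ (n - m) * Real.exp (-((1 - α) * δ * (geoBK i).dist a a')))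
      (fun f a' => ?_) M hM)
    fun a a' => le_of_eq (by ring)
  · -- `|g₁ f| ≤ c₁·ℓ_□(Δ_□f)⁻ᵐ`
    rw [← div_eq_mul_inv, le_div_iff₀ (pow_pos (hlenpos _) m)]
    exact hg₁ f
  · -- the comparison at the row bond `f`: `ℓ_□ⁿ·ℓ_□⁻ᵐ = ℓ_□^{n−m} ≤ ℓ^{n−m}`
    have hlx := hlenpos (blkCubeY i c (chartY i f.src))
    have hLC : (geoCK i c).len (blkCubeY i c (chartY i f.src)) ≤ (geoBK i).len (blkV1 i.hN i.D f) := len_cube_le_len_block i c (chartY i f.src)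
    have hpow : (geoCK i c).len (blkCubeY i c (chartY i f.src)) ^ n * ((geoCK i c).len (blkCubeY i c (chartY i f.src)) ^ m)⁻¹ =
        (geoCK i c).len (blkCubeY i c (chartY i f.src)) ^ (n - m) := by
      rw [pow_sub₀ _ hlx.ne' hmn]
    have hpw : (geoCK i c).len (blkCubeY i c (chartY i f.src)) ^ (n - m) ≤ (geoBK i).len (blkV1 i.hN i.D f) ^ (n - m) :=
      pow_le_pow_left₀ hlx.le hLC _
    have hpre : 0 ≤ c₁ * B * B6.c1 dB δ α := mul_nonneg (mul_nonneg hc₁ hB) (c1_nonneg _ _ _)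
    calc c₁ * ((geoCK i c).len (blkCubeY i c (chartY i f.src)) ^ m)⁻¹ * (geoCK i c).len (blkCubeY i c (chartY i f.src)) ^ n * (B * B6.c1 dB δ α) *
          Real.exp (-((1 - α) * δ * (geoBK i).dist (blkV1 i.hN i.D f) a'))
        = (c₁ * B * B6.c1 dB δ α) * ((geoCK i c).len (blkCubeY i c (chartY i f.src)) ^ n * ((geoCK i c).len (blkCubeY i c (chartY i f.src)) ^ m)⁻¹) *
          Real.exp (-((1 - α) * δ * (geoBK i).dist (blkV1 i.hN i.D f) a')) := by ring
      _ = (c₁ * B * B6.c1 dB δ α) * (geoCK i c).len (blkCubeY i c (chartY i f.src)) ^ (n - m) *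
          Real.exp (-((1 - α) * δ * (geoBK i).dist (blkV1 i.hN i.D f) a')) := by rw [hpow]
      _ ≤ (c₁ * B * B6.c1 dB δ α) * (geoBK i).len (blkV1 i.hN i.D f) ^ (n - m) *
          Real.exp (-((1 - α) * δ * (geoBK i).dist (blkV1 i.hN i.D f) a')) :=
          mul_le_mul_of_nonneg_right (mul_le_mul_of_nonneg_left hpw hpre) (Real.exp_nonneg _)

end Transfer

/-! ## §2  What `∇_U, ∇*_U, Δ_U` read on `Ω₀`-supported bond functions (gauge-free), the conjugation bookkeeping, and the three sandwich identities -/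

section Local

variable (i : KIdx d ℓ hd hL b₀ b₁)

/-- `(∇_{W,μ}Φ) = (∇_{W′,μ}Φ)` as functions when `Φ` vanishes off the bonds over `S` and `W_μ(z − e_μ) = W′_μ(z − e_μ)` for `z ∈ S` (what `∇_μ` reads at a bond
`f` is `W_μ(f₋)`, and only when `Φ(f + e_μ) ≠ 0`, i.e. `f₋ + e_μ ∈ S`). [cite: Balaban1985BackgroundPropagators, (3.3) p.390, p.410 l.14–15 («depend on U restricted to Ω₀(□)»)] -/
theorem cdB_eq_of_agree_of_supp {W W' : CfgY 𝔸 i} {S : Finset (SiteY i)}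
    (hS : ∀ z ∈ S, ∀ μ, UboxY i W μ z = UboxY i W' μ z ∧ UboxY i W μ ((shiftY i μ).symm z) = UboxY i W' μ ((shiftY i μ).symm z))
    {Φ : FBondY i → 𝔸} (hΦ : ∀ g : FBondY i, chartY i g.src ∉ S → Φ g = 0) (μ : Fin (d + 1)) :
    cdB i W μ Φ = cdB i W' μ Φ := by
  funext g
  by_cases h : chartY i (g.src.shift μ) ∈ S
  · have h2 := ((hS _ h μ).2)
    rw [← shiftY_chartY, Equiv.symm_apply_apply, UboxY_chartY, UboxY_chartY] at h2
    exact cdB_congr_pt i h2 Φ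
  · have h0 : Φ ⟨g.src.shift μ, g.dir⟩ = 0 := hΦ ⟨g.src.shift μ, g.dir⟩ h
    rw [cdB_apply_eq, cdB_apply_eq, h0, R_zero, R_zero]

/-- `𝟙_{Ω₀}(∇*_{W,μ}Λ) = 𝟙_{Ω₀}(∇*_{W′,μ}Λ)` when `W_μ(z − e_μ) = W′_μ(z − e_μ)` for `z ∈ S` (what `∇*_μ` reads at a bond `f` over `S` is `W_μ(f₋ − e_μ)`).
[cite: Balaban1985BackgroundPropagators, (3.8) p.392, p.410 l.14–15] -/
theorem indProjY_cdsB_eq_of_agree {W W' : CfgY 𝔸 i} {S : Finset (SiteY i)}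
    (hS : ∀ z ∈ S, ∀ μ, UboxY i W μ z = UboxY i W' μ z ∧ UboxY i W μ ((shiftY i μ).symm z) = UboxY i W' μ ((shiftY i μ).symm z))
    (μ : Fin (d + 1)) (Λ : FBondY i → 𝔸) :
    indProjY (bondsOverY i S) (cdsB i W μ Λ) = indProjY (bondsOverY i S) (cdsB i W' μ Λ) := by
  funext f
  rw [indProjY_apply, indProjY_apply]
  split_ifs with hf
  · have hz : chartY i f.src ∈ S := (mem_bondsOverY i).1 hf
    have h2 := (hS _ hz μ).2
    rw [shiftY_symm_chartY, UboxY_chartY, UboxY_chartY] at h2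
    exact cdsB_congr_pt i h2 Λ
  · rfl

/-- `(Δ_WΦ) = (Δ_{W′}Φ)` as functions when `Φ` vanishes off the bonds over `S` and `W, W′` agree on the bond variables `(μ, z)`, `(μ, z − e_μ)`, `z ∈ S`
(what `Δ = Σ_μ ∇*_μ∇_μ` reads at a bond `f` is `W_μ(f₋)` against `Φ(f + e_μ)` and `W_μ(f₋ − e_μ)` against `Φ(f − e_μ)`).
[cite: Balaban1985BackgroundPropagators, (3.23) p.394, p.410 l.14–15] -/
theorem lapB_eq_of_agree_of_supp {W W' : CfgY 𝔸 i} {S : Finset (SiteY i)}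
    (hS : ∀ z ∈ S, ∀ μ, UboxY i W μ z = UboxY i W' μ z ∧ UboxY i W μ ((shiftY i μ).symm z) = UboxY i W' μ ((shiftY i μ).symm z))
    {Φ : FBondY i → 𝔸} (hΦ : ∀ g : FBondY i, chartY i g.src ∉ S → Φ g = 0) :
    lapB i W Φ = lapB i W' Φ := by
  funext f
  show (∑ μ, cdsB i W μ (cdB i W μ Φ) f) = ∑ μ, cdsB i W' μ (cdB i W' μ Φ) f
  refine Finset.sum_congr rfl fun μ _ => ?_
  rw [cdB_eq_of_agree_of_supp i hS hΦ μ]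
  set Ψ : FBondY i → 𝔸 := cdB i W' μ Φ with hΨ
  by_cases h0 : Ψ ⟨f.src.unshift μ, f.dir⟩ = 0
  · rw [cdsB_apply_eq, cdsB_apply_eq, h0, R_zero, R_zero]
  · have key : W μ (f.src.unshift μ) = W' μ (f.src.unshift μ) := by
      by_cases h1 : chartY i (f.src.unshift μ) ∈ S
      · have h := (hS _ h1 μ).1
        rwa [UboxY_chartY, UboxY_chartY] at h
      · by_cases h2 : chartY i f.src ∈ S
        · have h := (hS _ h2 μ).2
          rwa [shiftY_symm_chartY, UboxY_chartY, UboxY_chartY] at h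
        · exfalso
          apply h0
          have e1 : Φ ⟨(f.src.unshift μ).shift μ, f.dir⟩ = 0 := by
            rw [shift_unshift]; exact hΦ ⟨f.src, f.dir⟩ h2
          have e2 : Φ ⟨f.src.unshift μ, f.dir⟩ = 0 := hΦ ⟨f.src.unshift μ, f.dir⟩ h1
          rw [hΨ, cdB_apply_eq]
          simp only [e1, e2, R_zero, sub_zero, smul_zero]
    exact cdsB_congr_pt i key Ψ

omit [CompleteSpace 𝔸] in
/-- `R(γ)⁻¹R(γ)Φ = Φ`. [cite: Balaban1985BackgroundPropagators, (3.28) p.395, bookkeeping] -/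
theorem conjY_inv_conjY {X : Type} (γ : X → 𝔸ˣ) (Φ : X → 𝔸) : conjY γ⁻¹ (conjY γ Φ) = Φ := by
  simpa only [inv_inv] using conjY_conjY_inv γ⁻¹ Φ

omit [CompleteSpace 𝔸] in
/-- an intertwining relation `L′R(γ) = R(γ)L` read as `L = R(γ)⁻¹L′R(γ)` on the real-linear letters (the bond companion of dag-n06-c's `rs_eq_of_intw`).
[cite: Balaban1985BackgroundPropagators, (3.31)–(3.34) pp.395–396] -/
theorem rs_eq_sandwich_of_intw {X : Type} (γ : X → 𝔸ˣ) {L L' : Module.End ℂ (X → 𝔸)} (h : Intw (conjY γ) (conjY γ) L L') :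
    (L.restrictScalars ℝ : Module.End ℝ (X → 𝔸)) =
      (conjY γ⁻¹).restrictScalars ℝ ∘ₗ L'.restrictScalars ℝ ∘ₗ (conjY γ).restrictScalars ℝ := by
  refine LinearMap.ext fun Φ => ?_
  simp only [LinearMap.comp_apply, LinearMap.restrictScalars_apply]
  have h' : L' (conjY γ Φ) = conjY γ (L Φ) := congrArg (fun T : (X → 𝔸) →ₗ[ℂ] (X → 𝔸) => T Φ) h
  rw [h', conjY_inv_conjY]

omit [CompleteSpace 𝔸] in
/-- the output support of `X = 𝟙_B·X`: `XΛ` vanishes off `B`. [cite: Balaban1985BackgroundPropagators, p.394 (Dirichlet boundary conditions), bookkeeping] -/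
theorem apply_eq_zero_of_indProjY_mul {X : Type} [DecidableEq X] {B : Finset X} {T : Module.End ℂ (X → 𝔸)} (hT : indProjY B * T = T) (Λ : X → 𝔸) {x : X}
    (hx : x ∉ B) : T Λ x = 0 := by
  rw [← hT, Module.End.mul_apply, indProjY_apply, if_neg hx]

variable (u : GaugeY 𝔸 i) (U V : CfgY 𝔸 i) (S : Finset (SiteY i))

/-- ★ **THE `∇`-WORD IDENTITY** `∇_{U,μ}∘(R(u)⁻¹XR(u)) = R(u)⁻¹∘(∇_{Ṽ,μ}∘X)∘R(u)` for `X = 𝟙_{Ω₀}X` and `Uᵘ = Ṽ` on the bond variables over `Ω₀` ((3.31)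
`∇_{Uᵘ}R(u) = R(u)∇_U`, then `∇_{Uᵘ} = ∇_{Ṽ}` on the `Ω₀`-supported output). [cite: Balaban1985BackgroundPropagators, (3.31) p.395, Cor. 3.6 p.408, p.410 l.14–15] -/
theorem cdBₗ_comp_sandwich
    (hS : ∀ z ∈ S, ∀ μ, UboxY i (gaugeY i u U) μ z = UboxY i V μ z ∧
      UboxY i (gaugeY i u U) μ ((shiftY i μ).symm z) = UboxY i V μ ((shiftY i μ).symm z))
    (X : Module.End ℂ (FBondY i → 𝔸)) (hX : indProjY (bondsOverY i S) * X = X) (μ : Fin (d + 1)) :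
    cdBₗ i U μ ∘ₗ ((conjY (gBondY i u)⁻¹).restrictScalars ℝ ∘ₗ X.restrictScalars ℝ ∘ₗ (conjY (gBondY i u)).restrictScalars ℝ) =
      (conjY (gBondY i u)⁻¹).restrictScalars ℝ ∘ₗ (cdBₗ i V μ ∘ₗ X.restrictScalars ℝ) ∘ₗ (conjY (gBondY i u)).restrictScalars ℝ := by
  refine LinearMap.ext fun Λ => ?_
  simp only [LinearMap.comp_apply, LinearMap.restrictScalars_apply, cdBₗ_apply]
  set Ψ : FBondY i → 𝔸 := X (conjY (gBondY i u) Λ) with hΨ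
  have hΨ0 : ∀ g : FBondY i, chartY i g.src ∉ S → Ψ g = 0 := fun g hg =>
    apply_eq_zero_of_indProjY_mul hX _ (mt (mem_bondsOverY i).1 hg)
  have hcov := cdB_conj i u U μ (conjY (gBondY i u)⁻¹ Ψ)
  rw [conjY_conjY_inv] at hcov
  have h1 : cdB i U μ (conjY (gBondY i u)⁻¹ Ψ) = conjY (gBondY i u)⁻¹ (cdB i (gaugeY i u U) μ Ψ) := by
    rw [hcov, conjY_inv_conjY]
  rw [h1, cdB_eq_of_agree_of_supp i hS hΨ0 μ]

/-- ★ **THE `∇*`-WORD IDENTITY** `(R(u)⁻¹XR(u))∘∇*_{U,μ} = R(u)⁻¹∘(X∘∇*_{Ṽ,μ})∘R(u)` for `X = X𝟙_{Ω₀}` and `Uᵘ = Ṽ` on the bond variables over `Ω₀` ((3.31)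
on the source side, then `𝟙_{Ω₀}∇*_{Uᵘ} = 𝟙_{Ω₀}∇*_{Ṽ}`). [cite: Balaban1985BackgroundPropagators, (3.31) p.395, (3.8) p.392, Cor. 3.6 p.408, p.410 l.14–15] -/
theorem sandwich_comp_cdsBₗ
    (hS : ∀ z ∈ S, ∀ μ, UboxY i (gaugeY i u U) μ z = UboxY i V μ z ∧
      UboxY i (gaugeY i u U) μ ((shiftY i μ).symm z) = UboxY i V μ ((shiftY i μ).symm z))
    (X : Module.End ℂ (FBondY i → 𝔸)) (hX : X * indProjY (bondsOverY i S) = X) (μ : Fin (d + 1)) :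
    ((conjY (gBondY i u)⁻¹).restrictScalars ℝ ∘ₗ X.restrictScalars ℝ ∘ₗ (conjY (gBondY i u)).restrictScalars ℝ) ∘ₗ cdsBₗ i U μ =
      (conjY (gBondY i u)⁻¹).restrictScalars ℝ ∘ₗ (X.restrictScalars ℝ ∘ₗ cdsBₗ i V μ) ∘ₗ (conjY (gBondY i u)).restrictScalars ℝ := by
  refine LinearMap.ext fun Λ => ?_
  simp only [LinearMap.comp_apply, LinearMap.restrictScalars_apply, cdsBₗ_apply]
  have e : ∀ A : FBondY i → 𝔸, X A = X (indProjY (bondsOverY i S) A) := fun A => by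
    rw [← Module.End.mul_apply, hX]
  rw [← cdsB_conj i u U μ Λ, e (cdsB i (gaugeY i u U) μ _), indProjY_cdsB_eq_of_agree i hS μ, ← e]

/-- ★ **THE `Δ`-WORD IDENTITY** `Δ_U∘(R(u)⁻¹XR(u)) = R(u)⁻¹∘(Δ_{Ṽ}∘X)∘R(u)` for `X = 𝟙_{Ω₀}X` and `Uᵘ = Ṽ` on the bond variables over `Ω₀`.
[cite: Balaban1985BackgroundPropagators, (3.31) p.395, (3.23) p.394, Cor. 3.6 p.408, p.410 l.14–15] -/
theorem lapBₗ_comp_sandwich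
    (hS : ∀ z ∈ S, ∀ μ, UboxY i (gaugeY i u U) μ z = UboxY i V μ z ∧
      UboxY i (gaugeY i u U) μ ((shiftY i μ).symm z) = UboxY i V μ ((shiftY i μ).symm z))
    (X : Module.End ℂ (FBondY i → 𝔸)) (hX : indProjY (bondsOverY i S) * X = X) :
    lapBₗ i U ∘ₗ ((conjY (gBondY i u)⁻¹).restrictScalars ℝ ∘ₗ X.restrictScalars ℝ ∘ₗ (conjY (gBondY i u)).restrictScalars ℝ) =
      (conjY (gBondY i u)⁻¹).restrictScalars ℝ ∘ₗ (lapBₗ i V ∘ₗ X.restrictScalars ℝ) ∘ₗ (conjY (gBondY i u)).restrictScalars ℝ := by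
  refine LinearMap.ext fun Λ => ?_
  simp only [LinearMap.comp_apply, LinearMap.restrictScalars_apply, lapBₗ_apply]
  set Ψ : FBondY i → 𝔸 := X (conjY (gBondY i u) Λ) with hΨ
  have hΨ0 : ∀ g : FBondY i, chartY i g.src ∉ S → Ψ g = 0 := fun g hg =>
    apply_eq_zero_of_indProjY_mul hX _ (mt (mem_bondsOverY i).1 hg)
  have hcov := lapB_conj i u U (conjY (gBondY i u)⁻¹ Ψ)
  rw [conjY_conjY_inv] at hcov
  have h1 : lapB i U (conjY (gBondY i u)⁻¹ Ψ) = conjY (gBondY i u)⁻¹ (lapB i (gaugeY i u U) Ψ) := by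
    rw [hcov, conjY_inv_conjY]
  rw [h1, lapB_eq_of_agree_of_supp i hS hΨ0]

end Local

/-! ## §3  ★★ A covariant `Ω₀`-supported bond letter at the member's blocks from its cube-side rows at the small field -/

section Member

variable (i : KIdx d ℓ hd hL b₀ b₁) (c : ↥(cubes (toKT i).D.toDomains)) (b : Module.Basis ι ℝ 𝔸)

omit [CompleteSpace 𝔸] in
/-- ★★ **ONE WORD**: the member-side block majorant of `conj b(R(γ)⁻¹∘W∘R(γ))` over `(toB6 (geoBK i) Rr′ Hp, y(b₋))` from the cube-side block majorant
`B·ℓ_□(a)ⁿ·e^{−δd_□}` of `conj b(W)` over `(toB6 (geoCK i □) Rr H, blkBK i □)` — §1 with no row multiplier: constant `(M₂Σ‖b‖)²·B·c₁(δ,α)`, weight `ℓ(a)ⁿ`, rate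
`(1−α)δ`. [cite: Balaban1985BackgroundPropagators, Cor. 3.6 p.408 l.11–14, p.409 l.1–5; Balaban1984PropagatorsII, (2.51) p.232, Lemma 2.1 (2.61) p.234] -/
theorem transfer_sandwich_decay {M₂ : ℝ} (hM₂ : 0 ≤ M₂) (hrepr : ∀ (v : 𝔸) (j : ι), |b.repr v j| ≤ M₂ * ‖v‖)
    (γ : FBondY i → 𝔸ˣ) (hγ : ∀ f a, ‖R (γ f) a‖ ≤ ‖a‖ ∧ ‖R (γ f)⁻¹ a‖ ≤ ‖a‖)
    (Rr : ℝ) (H : Prop) [Fintype (geoBK i).Site] (Rr' : ℝ) (Hp : Prop)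
    (dB : ℕ) {B δ α : ℝ} (hB : 0 ≤ B) (hδ : 0 ≤ δ) (hα1 : α ≤ 1) (h261 : Ineq261 dB (toB6 (geoCK i c) Rr H) δ α) (n : ℕ)
    (W : Module.End ℝ (FBondY i → 𝔸))
    (hW : HasMajorant (g := toB6 (geoCK i c) Rr H) (blkBK i c) (conj b W)
      (fun a s => B * (geoCK i c).len a ^ n * Real.exp (-(δ * (geoCK i c).dist a s)))) :
    HasMajorant (g := toB6 (geoBK i) Rr' Hp) (fun p : FBondY i × ι => blkV1 i.hN i.D p.1)
      (conj b ((conjY γ⁻¹).restrictScalars ℝ ∘ₗ W ∘ₗ (conjY γ).restrictScalars ℝ))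
      (fun a a' => (M₂ * ∑ j, ‖b j‖) ^ 2 * (B * B6.c1 dB δ α) * (geoBK i).len a ^ n *
        Real.exp (-((1 - α) * δ * (geoBK i).dist a a'))) := by
  have T := hasMajorant_conj_bond_sandwich_src_global_decay_blocks i c b hM₂ hrepr γ hγ (fun _ => (1 : ℝ)) (c₁ := 1) zero_le_one
    (m := 0) (n := n) (Nat.zero_le n) (fun f => by simp) Rr H Rr' Hp dB hB hδ hα1 h261 W hW
  have e : (cutMulY (𝔸 := 𝔸) (fun _ : FBondY i => (1 : ℝ))).restrictScalars ℝ ∘ₗ (conjY γ⁻¹).restrictScalars ℝ ∘ₗ W ∘ₗ (conjY γ).restrictScalars ℝ =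
      (conjY γ⁻¹).restrictScalars ℝ ∘ₗ W ∘ₗ (conjY γ).restrictScalars ℝ := by
    refine LinearMap.ext fun Λ => funext fun f => ?_
    simp only [LinearMap.comp_apply, LinearMap.restrictScalars_apply, cutMulY_apply, Complex.ofReal_one, one_smul]
  refine hasMajorant_mono (g := toB6 (geoBK i) Rr' Hp) _ (hasMajorant_congr_op T (by rw [e])) fun a a' => le_of_eq ?_
  rw [Nat.sub_zero]; ring

/-- ★★ **A COVARIANT `Ω₀`-SUPPORTED BOND LETTER AT THE MEMBER's BLOCKS FROM ITS CUBE-SIDE ROWS AT THE SMALL FIELD.**  Data: a unit field `u` on sites, bi-contractive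
on bonds; configurations `U` (the member's) and `Ṽ` (the small field) with `Uᵘ = Ṽ` on the bond variables `(μ, z)`, `(μ, z − e_μ)`, `z ∈ Ω₀` (clause (i) of
`AgreeDirCY`); a `ℂ`-linear bond operator `X` (the letter at `Ṽ`) with `𝟙_{Ω₀}X = X = X𝟙_{Ω₀}` and `XU` (the letter at `U`) with `XU = R(u)⁻¹XR(u)` on the
real-linear letters (covariance (3.34) + locality); the four cube-side rows of `X` at `Ṽ` over `(toB6 (geoCK i □) Rr H, blkBK i □)` with constants
`B·ℓ_□^{2,1,1,0}·e^{−δd_□}` in the covariant-at-`Ṽ` derivative letters; (2.61) on the cube geometry at the splitting exponent `α ≤ 1`.  Conclusion: the four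
member-side rows of `XU` with the MEMBER's derivatives `∇_{U,ν}, ∇*_{U,ν}, Δ_U` over `(toB6 (geoBK i) Rr′ Hp, y(b₋))`, constant `(M₂Σ‖b‖)²·B·c₁(δ,α)`, weights
`ℓ(a)^{2,1,1,0}`, rate `(1−α)δ` — «all the results of these theorems are gauge invariant, so they hold for the configuration U also».
[cite: Balaban1985BackgroundPropagators, Cor. 3.6 p.408 l.11–14, (3.34) p.396, (3.31) p.395, p.409 l.1–5, p.410 l.14–15, Thm 3.1 (3.42) p.397, Thm 3.3 p.399; Balaban1984PropagatorsII, (2.51)–(2.52) p.232, Lemma 2.1 (2.61) p.234] -/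
theorem covBondLetter_at_member_blocks_of_entries {M₂ : ℝ} (hM₂ : 0 ≤ M₂) (hrepr : ∀ (v : 𝔸) (j : ι), |b.repr v j| ≤ M₂ * ‖v‖)
    (u : GaugeY 𝔸 i) (hu : ∀ (f : FBondY i) (a : 𝔸), ‖R (gBondY i u f) a‖ ≤ ‖a‖ ∧ ‖R (gBondY i u f)⁻¹ a‖ ≤ ‖a‖)
    (U V : CfgY 𝔸 i) (S : Finset (SiteY i))
    (hS : ∀ z ∈ S, ∀ μ, UboxY i (gaugeY i u U) μ z = UboxY i V μ z ∧
      UboxY i (gaugeY i u U) μ ((shiftY i μ).symm z) = UboxY i V μ ((shiftY i μ).symm z))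
    (X XU : Module.End ℂ (FBondY i → 𝔸))
    (hXU : (XU.restrictScalars ℝ : Module.End ℝ (FBondY i → 𝔸)) =
      (conjY (gBondY i u)⁻¹).restrictScalars ℝ ∘ₗ X.restrictScalars ℝ ∘ₗ (conjY (gBondY i u)).restrictScalars ℝ)
    (hXl : indProjY (bondsOverY i S) * X = X) (hXr : X * indProjY (bondsOverY i S) = X)
    (Rr : ℝ) (H : Prop) [Fintype (geoBK i).Site] (Rr' : ℝ) (Hp : Prop)
    (dB : ℕ) {B δ α : ℝ} (hB : 0 ≤ B) (hδ : 0 ≤ δ) (hα1 : α ≤ 1) (h261 : Ineq261 dB (toB6 (geoCK i c) Rr H) δ α)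
    (E0 : HasMajorant (g := toB6 (geoCK i c) Rr H) (blkBK i c) (conj b (X.restrictScalars ℝ))
      (fun a s => B * (geoCK i c).len a ^ 2 * Real.exp (-(δ * (geoCK i c).dist a s))))
    (E1 : ∀ ν : Fin (d + 1), HasMajorant (g := toB6 (geoCK i c) Rr H) (blkBK i c) (conj b (cdBₗ i V ν) * conj b (X.restrictScalars ℝ))
      (fun a s => B * (geoCK i c).len a * Real.exp (-(δ * (geoCK i c).dist a s))))
    (E2 : ∀ ν : Fin (d + 1), HasMajorant (g := toB6 (geoCK i c) Rr H) (blkBK i c) (conj b (X.restrictScalars ℝ) * conj b (cdsBₗ i V ν))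
      (fun a s => B * (geoCK i c).len a * Real.exp (-(δ * (geoCK i c).dist a s))))
    (E3 : HasMajorant (g := toB6 (geoCK i c) Rr H) (blkBK i c) (conj b (lapBₗ i V) * conj b (X.restrictScalars ℝ))
      (fun a s => B * Real.exp (-(δ * (geoCK i c).dist a s)))) :
    HasMajorant (g := toB6 (geoBK i) Rr' Hp) (fun p : FBondY i × ι => blkV1 i.hN i.D p.1) (conj b (XU.restrictScalars ℝ))
        (fun a a' => (M₂ * ∑ j, ‖b j‖) ^ 2 * (B * B6.c1 dB δ α) * (geoBK i).len a ^ 2 * Real.exp (-((1 - α) * δ * (geoBK i).dist a a'))) ∧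
      (∀ ν : Fin (d + 1), HasMajorant (g := toB6 (geoBK i) Rr' Hp) (fun p : FBondY i × ι => blkV1 i.hN i.D p.1)
        (conj b (cdBₗ i U ν) * conj b (XU.restrictScalars ℝ))
        (fun a a' => (M₂ * ∑ j, ‖b j‖) ^ 2 * (B * B6.c1 dB δ α) * (geoBK i).len a * Real.exp (-((1 - α) * δ * (geoBK i).dist a a')))) ∧
      (∀ ν : Fin (d + 1), HasMajorant (g := toB6 (geoBK i) Rr' Hp) (fun p : FBondY i × ι => blkV1 i.hN i.D p.1)
        (conj b (XU.restrictScalars ℝ) * conj b (cdsBₗ i U ν))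
        (fun a a' => (M₂ * ∑ j, ‖b j‖) ^ 2 * (B * B6.c1 dB δ α) * (geoBK i).len a * Real.exp (-((1 - α) * δ * (geoBK i).dist a a')))) ∧
      HasMajorant (g := toB6 (geoBK i) Rr' Hp) (fun p : FBondY i × ι => blkV1 i.hN i.D p.1)
        (conj b (lapBₗ i U) * conj b (XU.restrictScalars ℝ))
        (fun a a' => (M₂ * ∑ j, ‖b j‖) ^ 2 * (B * B6.c1 dB δ α) * 1 * Real.exp (-((1 - α) * δ * (geoBK i).dist a a'))) := by
  refine ⟨?_, fun ν => ?_, fun ν => ?_, ?_⟩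
  · -- (3.42)₁: `XU = R(u)⁻¹XR(u)`
    have T := transfer_sandwich_decay i c b hM₂ hrepr (gBondY i u) hu Rr H Rr' Hp dB hB hδ hα1 h261 2 (X.restrictScalars ℝ) E0
    exact hasMajorant_congr_op T (by rw [hXU])
  · -- (3.42)₂: `∇_{U,ν}XU = R(u)⁻¹(∇_{Ṽ,ν}X)R(u)`
    have E1' : HasMajorant (g := toB6 (geoCK i c) Rr H) (blkBK i c) (conj b (cdBₗ i V ν ∘ₗ X.restrictScalars ℝ))
        (fun a s => B * (geoCK i c).len a ^ 1 * Real.exp (-(δ * (geoCK i c).dist a s))) := by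
      simpa only [pow_one, ← Module.End.mul_eq_comp, B9Eq352DivFormLetters.conj_mul] using E1 ν
    have T := transfer_sandwich_decay i c b hM₂ hrepr (gBondY i u) hu Rr H Rr' Hp dB hB hδ hα1 h261 1 _ E1'
    refine hasMajorant_congr_op (hasMajorant_mono (g := toB6 (geoBK i) Rr' Hp) _ T fun a a' => by rw [pow_one]) ?_
    rw [← B9Eq352DivFormLetters.conj_mul, Module.End.mul_eq_comp, hXU, cdBₗ_comp_sandwich i u U V S hS X hXl ν]
  · -- (3.42)₃: `XU∇*_{U,ν} = R(u)⁻¹(X∇*_{Ṽ,ν})R(u)`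
    have E2' : HasMajorant (g := toB6 (geoCK i c) Rr H) (blkBK i c) (conj b (X.restrictScalars ℝ ∘ₗ cdsBₗ i V ν))
        (fun a s => B * (geoCK i c).len a ^ 1 * Real.exp (-(δ * (geoCK i c).dist a s))) := by
      simpa only [pow_one, ← Module.End.mul_eq_comp, B9Eq352DivFormLetters.conj_mul] using E2 ν
    have T := transfer_sandwich_decay i c b hM₂ hrepr (gBondY i u) hu Rr H Rr' Hp dB hB hδ hα1 h261 1 _ E2'
    refine hasMajorant_congr_op (hasMajorant_mono (g := toB6 (geoBK i) Rr' Hp) _ T fun a a' => by rw [pow_one]) ?_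
    rw [← B9Eq352DivFormLetters.conj_mul, Module.End.mul_eq_comp, hXU, sandwich_comp_cdsBₗ i u U V S hS X hXr ν]
  · -- (3.42)₄: `Δ_U XU = R(u)⁻¹(Δ_{Ṽ}X)R(u)`
    have E3' : HasMajorant (g := toB6 (geoCK i c) Rr H) (blkBK i c) (conj b (lapBₗ i V ∘ₗ X.restrictScalars ℝ))
        (fun a s => B * (geoCK i c).len a ^ 0 * Real.exp (-(δ * (geoCK i c).dist a s))) := by
      simpa only [pow_zero, mul_one, ← Module.End.mul_eq_comp, B9Eq352DivFormLetters.conj_mul] using E3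
    have T := transfer_sandwich_decay i c b hM₂ hrepr (gBondY i u) hu Rr H Rr' Hp dB hB hδ hα1 h261 0 _ E3'
    refine hasMajorant_congr_op (hasMajorant_mono (g := toB6 (geoBK i) Rr' Hp) _ T fun a a' => by rw [pow_zero]) ?_
    rw [← B9Eq352DivFormLetters.conj_mul, Module.End.mul_eq_comp, hXU, lapBₗ_comp_sandwich i u U V S hS X hXl]

end Member

/-! ## §4  ★★★ At the letter of record `G_□(U) = GDirCKY i □ (DP_□D* of record) (bondsOverY Ω₀(□))` -/

section Record

open scoped Matrix.Norms.L2Operator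

variable {N : ℕ} [Nonempty (Fin N)] (i : KIdx d ℓ hd hL b₀ b₁) (q : ↥(cubes (toKT i).D.toDomains))
  {u : GaugeY (Matrix (Fin N) (Fin N) ℂ) i} (U V : CfgY (Matrix (Fin N) (Fin N) ℂ) i)

/-- a unitary-valued gauge function rotates the bond functions bi-contractively. [cite: Balaban1985BackgroundPropagators, (3.28) p.395, (3.35) p.396 (G-valued), bookkeeping] -/
theorem gBondY_biContr (hg : ∀ x, u x ∈ unitaryUnits (Matrix (Fin N) (Fin N) ℂ)) :
    ∀ (f : FBondY i) (a : Matrix (Fin N) (Fin N) ℂ), ‖R (gBondY i u f) a‖ ≤ ‖a‖ ∧ ‖R (gBondY i u f)⁻¹ a‖ ≤ ‖a‖ := by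
  letI : CStarAlgebra (Matrix (Fin N) (Fin N) ℂ) := {}
  exact fun f a => ⟨norm_R_le_of_mem_unitaryUnits (hg f.src) a, norm_R_le_of_mem_unitaryUnits ((unitaryUnits _).inv_mem (hg f.src)) a⟩

/-- ★★ **THE HEADS' REGIME CLAUSE `hUnitA` AT `U` FROM THE DATUM**: if `Uᵘ` and `Ṽ` agree in the sense `AgreeDirCY Ω₀` (`u` unitary-valued) and
`padΔ_{loc,□}[Q^knit_□](Ṽ) − DP_□D*(Ṽ)` (padded to `Ω₀`) is a unit, so is the same object at `U` (locality `Ṽ ↦ Uᵘ`, covariance `Uᵘ ↦ U`).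
[cite: Balaban1985BackgroundPropagators, Cor. 3.6 p.408 («applied to the configuration U′ = Uᵘ»), (3.34) p.396, p.409 l.3–5, p.410 l.14–15] -/
theorem isUnit_padDeltaLocCKY_of_datum (hg : ∀ x, u x ∈ unitaryUnits (Matrix (Fin N) (Fin N) ℂ)) (S : Finset (SiteY i))
    (hAgr : AgreeDirCY i q (fun ι => knitDepP i ι.1) S (gaugeY i u U) V)
    (hV : IsUnit (padDeltaLocCY i q (QknitCubeY i q) (QsknitCubeY i q) (DPDsDirCubeY i q S) (bondsOverY i S) V)) :
    IsUnit (padDeltaLocCY i q (QknitCubeY i q) (QsknitCubeY i q) (DPDsDirCubeY i q S) (bondsOverY i S) U) :=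
  (isUnit_padDeltaLocCKY_gaugeY_iff i q U hg S (bondsOverY i S)).1 ((isUnit_padDeltaLocCY_knit_iff_of_agreeDirCY i q S hAgr).2 hV)

/-- ★ **(3.34) + LOCALITY FOR THE LETTER OF RECORD ON THE REAL-LINEAR LETTERS**: `G_□(U) = R(u)⁻¹G_□(Ṽ)R(u)` once `Uᵘ` and `Ṽ` agree in the sense
`AgreeDirCY Ω₀` (`u` unitary-valued). [cite: Balaban1985BackgroundPropagators, (3.34) p.396, Cor. 3.6 p.408, p.409 l.3–5, p.410 l.14–15] -/
theorem GDirCKY_rs_eq_sandwich (hg : ∀ x, u x ∈ unitaryUnits (Matrix (Fin N) (Fin N) ℂ)) (S : Finset (SiteY i))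
    (hAgr : AgreeDirCY i q (fun ι => knitDepP i ι.1) S (gaugeY i u U) V) :
    ((GDirCKY i q (DPDsDirCubeY i q S) (bondsOverY i S) U).restrictScalars ℝ : Module.End ℝ (FBondY i → Matrix (Fin N) (Fin N) ℂ)) =
      (conjY (gBondY i u)⁻¹).restrictScalars ℝ ∘ₗ (GDirCKY i q (DPDsDirCubeY i q S) (bondsOverY i S) V).restrictScalars ℝ ∘ₗ
        (conjY (gBondY i u)).restrictScalars ℝ := by
  rw [← GDirCKY_congr_of_agreeDirCY i q S hAgr]
  exact rs_eq_sandwich_of_intw (gBondY i u) (GDirCKY_cov i q U hg S (bondsOverY i S))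

/-- ★★★ **PRINT's DIRICHLET BOND LETTER OF THE CUBE SEQUENCE AT THE MEMBER's BLOCKS** («all the results of these theorems are gauge invariant, so they hold for the
configuration U also», FOR `G_□(U)` OF p. 409 l. 3–5 in the letter (C) of record).  Data: a unitary-valued gauge function `u` and a configuration `Ṽ` with
`AgreeDirCY Ω₀ (Uᵘ) Ṽ` (the (3.35) datum: `Ṽ = Uᵘ` on everything `G_□` reads); the four cube-side rows of `G_□(Ṽ)` over `(toB6 (geoCK i □) Rr H, blkBK i □)` with
constants `B·ℓ_□^{2,1,1,0}·e^{−δd_□}` in the covariant-at-`Ṽ` derivative letters (dag-n06-c's road (B5): Cor. 3.5 ∕ (3.85) for the Dirichlet bond letter — an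
INPUT here); (2.61) on the cube geometry at the splitting exponent `α ≤ 1`.  Conclusion: the heads' four `h36Ab`-shaped rows of `G_□(U)` with the member's
`∇_{U,ν}, ∇*_{U,ν}, Δ_U` over the all-blocks geometry `(toB6 (geoBK i) Rr′ Hp, y(b₋))`, constant `(M₂Σ‖b‖)²·B·c₁(δ,α)`, weights `ℓ(a)^{2,1,1,0}`, rate `(1−α)δ`.
Covariance `GDirCKY_cov`, locality `GDirCKY_congr_of_agreeDirCY`, support `indProjY_mul_GDirCY` ∕ `GDirCY_mul_indProjY` BY NAME; the regime clause is
`isUnit_padDeltaLocCKY_of_datum`.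
[cite: Balaban1985BackgroundPropagators, Cor. 3.6 p.408 l.1–14, (3.34) p.396, (3.31) p.395, p.409 l.1–5, p.410 l.14–15, Thm 3.1 (3.42) p.397, Thm 3.3 p.399; Balaban1984PropagatorsII, (2.51)–(2.52) p.232, (2.46) p.231, Lemma 2.1 (2.61) p.234] -/
theorem gDirCK_at_member_blocks_of_entries {ι : Type} [Fintype ι] (b : Module.Basis ι ℝ (Matrix (Fin N) (Fin N) ℂ))
    {M₂ : ℝ} (hM₂ : 0 ≤ M₂) (hrepr : ∀ (v : Matrix (Fin N) (Fin N) ℂ) (j : ι), |b.repr v j| ≤ M₂ * ‖v‖)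
    (hg : ∀ x, u x ∈ unitaryUnits (Matrix (Fin N) (Fin N) ℂ)) (S : Finset (SiteY i))
    (hAgr : AgreeDirCY i q (fun ι => knitDepP i ι.1) S (gaugeY i u U) V)
    (Rr : ℝ) (H : Prop) [Fintype (geoBK i).Site] (Rr' : ℝ) (Hp : Prop)
    (dB : ℕ) {B δ α : ℝ} (hB : 0 ≤ B) (hδ : 0 ≤ δ) (hα1 : α ≤ 1) (h261 : Ineq261 dB (toB6 (geoCK i q) Rr H) δ α)
    (E0 : HasMajorant (g := toB6 (geoCK i q) Rr H) (blkBK i q)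
      (conj b ((GDirCKY i q (DPDsDirCubeY i q S) (bondsOverY i S) V).restrictScalars ℝ))
      (fun a s => B * (geoCK i q).len a ^ 2 * Real.exp (-(δ * (geoCK i q).dist a s))))
    (E1 : ∀ ν : Fin (d + 1), HasMajorant (g := toB6 (geoCK i q) Rr H) (blkBK i q)
      (conj b (cdBₗ i V ν) * conj b ((GDirCKY i q (DPDsDirCubeY i q S) (bondsOverY i S) V).restrictScalars ℝ))
      (fun a s => B * (geoCK i q).len a * Real.exp (-(δ * (geoCK i q).dist a s))))
    (E2 : ∀ ν : Fin (d + 1), HasMajorant (g := toB6 (geoCK i q) Rr H) (blkBK i q)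
      (conj b ((GDirCKY i q (DPDsDirCubeY i q S) (bondsOverY i S) V).restrictScalars ℝ) * conj b (cdsBₗ i V ν))
      (fun a s => B * (geoCK i q).len a * Real.exp (-(δ * (geoCK i q).dist a s))))
    (E3 : HasMajorant (g := toB6 (geoCK i q) Rr H) (blkBK i q)
      (conj b (lapBₗ i V) * conj b ((GDirCKY i q (DPDsDirCubeY i q S) (bondsOverY i S) V).restrictScalars ℝ))
      (fun a s => B * Real.exp (-(δ * (geoCK i q).dist a s)))) :
    HasMajorant (g := toB6 (geoBK i) Rr' Hp) (fun p : FBondY i × ι => blkV1 i.hN i.D p.1)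
        (conj b ((GDirCKY i q (DPDsDirCubeY i q S) (bondsOverY i S) U).restrictScalars ℝ))
        (fun a a' => (M₂ * ∑ j, ‖b j‖) ^ 2 * (B * B6.c1 dB δ α) * (geoBK i).len a ^ 2 * Real.exp (-((1 - α) * δ * (geoBK i).dist a a'))) ∧
      (∀ ν : Fin (d + 1), HasMajorant (g := toB6 (geoBK i) Rr' Hp) (fun p : FBondY i × ι => blkV1 i.hN i.D p.1)
        (conj b (cdBₗ i U ν) * conj b ((GDirCKY i q (DPDsDirCubeY i q S) (bondsOverY i S) U).restrictScalars ℝ))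
        (fun a a' => (M₂ * ∑ j, ‖b j‖) ^ 2 * (B * B6.c1 dB δ α) * (geoBK i).len a * Real.exp (-((1 - α) * δ * (geoBK i).dist a a')))) ∧
      (∀ ν : Fin (d + 1), HasMajorant (g := toB6 (geoBK i) Rr' Hp) (fun p : FBondY i × ι => blkV1 i.hN i.D p.1)
        (conj b ((GDirCKY i q (DPDsDirCubeY i q S) (bondsOverY i S) U).restrictScalars ℝ) * conj b (cdsBₗ i U ν))
        (fun a a' => (M₂ * ∑ j, ‖b j‖) ^ 2 * (B * B6.c1 dB δ α) * (geoBK i).len a * Real.exp (-((1 - α) * δ * (geoBK i).dist a a')))) ∧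
      HasMajorant (g := toB6 (geoBK i) Rr' Hp) (fun p : FBondY i × ι => blkV1 i.hN i.D p.1)
        (conj b (lapBₗ i U) * conj b ((GDirCKY i q (DPDsDirCubeY i q S) (bondsOverY i S) U).restrictScalars ℝ))
        (fun a a' => (M₂ * ∑ j, ‖b j‖) ^ 2 * (B * B6.c1 dB δ α) * 1 * Real.exp (-((1 - α) * δ * (geoBK i).dist a a'))) :=
  covBondLetter_at_member_blocks_of_entries i q b hM₂ hrepr u (gBondY_biContr i hg) U V S hAgr.1
    (GDirCKY i q (DPDsDirCubeY i q S) (bondsOverY i S) V) (GDirCKY i q (DPDsDirCubeY i q S) (bondsOverY i S) U)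
    (GDirCKY_rs_eq_sandwich i q U V hg S hAgr) (indProjY_mul_GDirCY i q _ _ _ _ V) (GDirCY_mul_indProjY i q _ _ _ _ V)
    Rr H Rr' Hp dB hB hδ hα1 h261 E0 E1 E2 E3

end Record

end Literature.MathematicalPhysics.QuantumFieldTheory.Balaban1983to89.B9CubeDirInverseBondCAtMemberBlocksY

end
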